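import Mathlib
import Literature.Analysis.UnboundedOperators.HeatKernelBoundedData
import Literature.Analysis.UnboundedOperators.HeatKernelHeatEquation
import Literature.Analysis.UnboundedOperators.HeatExtensionJointSmooth
import Literature.Analysis.UnboundedOperators.HeatIteratedDerivBounds
import Literature.Analysis.UnboundedOperators.HeatExtensionDecay
import Literature.Analysis.FluidPDE.SpaceTimeCalculus
import Summits.NavierStokesRegularity.NavierStokesRegularity.Theorems.FilamentSkeletonRssKelvinGateOUKernel

/-!
# Route `FilamentSkeletonRss` · crux `TransverseReductionRJ` (stmt-NavierStokesRegularity-21221) — line `kelvin_gate`,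
# stub S2′ `EventualKelvinGate`: the FREE SEMIGROUP `e^{-s𝓛}` of the linearised profile operator at the trivial base

Helper file (theorems only, `--supports stmt-NavierStokesRegularity-21221 --as helper`).  HONEST FRAMING:
analysis bookkeeping for a HYPOTHETICAL filament-type rotating-self-similar blow-up route; nothing here
bears on Navier–Stokes regularity; no stub is proved here.

For a bounded continuous forcing `F : ℝ³ → ℝ³`, a rate `α` and `s > 0` the free semigroup slice is the field

  `W_s(y) = (e^{-s/2} R_{−αs}) (e^{(1 − e^{-s})Δ} F)(e^{-s/2} R_{αs} y)`

(caloric extension `e^{τΔ} = heatExtension · τ` of `Literature.Analysis.UnboundedOperators`, heat time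
`τ_s = 1 − e^{-s}`, similarity dilation `e^{-s/2}`, rotating frame `R_{±αs}`; written out in every statement —
this file declares no definition).  Main results:

* `hasDerivAt_freeSlice` — **`∂_s W_s(y) = −𝓛_(α,0) W_s (y)`** for `s > 0`, where
  `𝓛_(α,0) W = α (e₃ × W − DW[e₃ × y]) + ½ W + ½ DW[y] − ΔW` is the line's `lerayLin α 0`
  (heat equation for the caloric extension + the chain rule through `(τ_s, e^{-s/2} R_{αs} y)` +
  `d/ds (e^{-s/2} R_{∓αs})` from `…KelvinGateOUKernel` + the conjugation identity `lerayLin_zero_conj`);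
* `norm_freeSlice_le` — `‖W_s(y)‖ ≤ e^{-s/2} sup ‖F‖;
* `tendsto_freeSlice_zero` — `W_s(y) → F(y)` as `s → 0⁺`; `tendsto_freeSlice_atTop` — `W_s(y) → 0` as `s → ∞`;
* `hasFDerivAt_freeSlice_space`, `hasFDerivAt_fderiv_freeSlice`, `norm_fderiv_freeSlice_le`,
  `norm_fderiv_fderiv_freeSlice_le` — the first two SPACE derivatives of the slice (chain rule through the
  rotation–dilation) with the sizes `‖DW_s(y)‖ ≤ e^{-s} ‖D(e^{τ_sΔ}F)(x)‖`, `‖D²W_s(y)‖ ≤ e^{-3s/2} ‖D²(e^{τ_sΔ}F)(x)‖`,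
  and, for `F ∈ C¹` with `‖DF‖ ≤ C₁`, `‖D(e^{τΔ}F)‖ ≤ C₁`, `‖D²(e^{τΔ}F)‖ ≤ 2^{3/2} τ^{-1/2} C₁`
  (`norm_fderiv_heatExtension_le_of_C1`, `norm_fderiv_fderiv_heatExtension_le_of_C1`).

The resolvent `W = ∫₀^∞ W_s ds` (free gate, velocity part) is assembled in the next file of the line.
-/

set_option linter.dupNamespace false

noncomputable section

namespace Summit.NavierStokesRegularity.NavierStokesRegularity.Theorems.KelvinGate

open Set Function Filter Topology InnerProductSpace MeasureTheory
open Literature.Analysis.FluidPDE Literature.Analysis.UnboundedOperators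
open scoped Laplacian RealInnerProductSpace ContDiff Topology ENNReal

/-! ## Small facts about the time scales -/

/-- The heat time `τ_s = 1 − e^{-s}` lies in `(0, 1]` for `s > 0`. -/
theorem heatTime_mem_Ioc {s : ℝ} (hs : 0 < s) : 1 - Real.exp (-s) ∈ Set.Ioc (0:ℝ) 1 := by
  have h1 : Real.exp (-s) < 1 := Real.exp_lt_one_iff.mpr (by linarith)
  have h2 := Real.exp_pos (-s)
  constructor <;> linarith

/-- `d/ds (1 − e^{-s}) = e^{-s}`. -/
theorem hasDerivAt_heatTime (s : ℝ) : HasDerivAt (fun t : ℝ => 1 - Real.exp (-t)) (Real.exp (-s)) s := by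
  have h := ((hasDerivAt_id s).fun_neg.exp).const_sub 1
  simpa using h

/-- `(e^{-s/2})² = e^{-s}`. -/
theorem exp_neg_half_sq' (s : ℝ) : Real.exp (-(s / 2)) ^ 2 = Real.exp (-s) := by
  rw [sq, ← Real.exp_add]; congr 1; ring

/-- The generator commutes with the dilation–rotation maps: `J ∘ (c R_θ) = (c R_θ) ∘ J`. -/
theorem rotGenL_comp_smul_rotZL (c θ : ℝ) :
    rotGenL.comp (c • rotZL θ) = (c • rotZL θ).comp rotGenL := by
  rw [ContinuousLinearMap.comp_smul, ContinuousLinearMap.smul_comp, rotGenL_comp_rotZL]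

/-! ## The joint derivative of the caloric extension -/

section Slice

variable {F : EuclideanSpace ℝ (Fin 3) → EuclideanSpace ℝ (Fin 3)} {C : ℝ}

/-- For bounded continuous data the caloric extension is jointly differentiable on `(0, ∞) × ℝ³`, and its
joint derivative at `(τ, x)` acts by `(a, v) ↦ a • Δ(e^{τΔ}F)(x) + D(e^{τΔ}F)(x)[v]` (heat equation in the
time slot, slice derivative in the space slot). -/
theorem hasFDerivAt_uncurry_heatExtension (hF : Continuous F) (hC : ∀ z, ‖F z‖ ≤ C) {τ : ℝ} (hτ : 0 < τ)
    (x : EuclideanSpace ℝ (Fin 3)) :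
    ∃ L : ℝ × EuclideanSpace ℝ (Fin 3) →L[ℝ] EuclideanSpace ℝ (Fin 3),
      HasFDerivAt (uncurry (heatExtension F)) L (τ, x) ∧
      ∀ (a : ℝ) (v : EuclideanSpace ℝ (Fin 3)),
        L (a, v) = a • (Δ (heatExtension F τ)) x + fderiv ℝ (heatExtension F τ) x v := by
  have hmem : MemLp F ∞ (volume : Measure (EuclideanSpace ℝ (Fin 3))) :=
    memLp_top_of_continuous_of_bound hF hC
  have hsm := contDiffOn_heatExtension_prod hmem le_top
  have hmemS : ((τ, x) : ℝ × EuclideanSpace ℝ (Fin 3)) ∈ Ioi (0:ℝ) ×ˢ (univ : Set (EuclideanSpace ℝ (Fin 3))) :=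
    mk_mem_prod hτ (mem_univ _)
  have hopen : IsOpen (Ioi (0:ℝ) ×ˢ (univ : Set (EuclideanSpace ℝ (Fin 3)))) := isOpen_Ioi.prod isOpen_univ
  have hdiff : DifferentiableAt ℝ (uncurry (heatExtension F)) (τ, x) :=
    (hsm.differentiableOn (by simp)).differentiableAt (hopen.mem_nhds hmemS)
  set L := fderiv ℝ (uncurry (heatExtension F)) (τ, x) with hL
  have hHas : HasFDerivAt (uncurry (heatExtension F)) L (τ, x) := hdiff.hasFDerivAt
  refine ⟨L, hHas, fun a v => ?_⟩
  -- time slot: heat equation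
  have h1 : L (1, 0) = (Δ (heatExtension F τ)) x :=
    (hasDerivAt_timeLine hHas).unique (hasDerivAt_heatExtension_time hτ hmem le_top x)
  -- space slot: slice derivative
  have h2 : L (0, v) = fderiv ℝ (heatExtension F τ) x v := by
    rw [(hasFDerivAt_slice hHas).fderiv]
    simp
  have hsplit : ((a, v) : ℝ × EuclideanSpace ℝ (Fin 3)) = a • ((1:ℝ), (0 : EuclideanSpace ℝ (Fin 3))) + ((0:ℝ), v) := by
    simp
  rw [hsplit, map_add, map_smul, h1, h2]

/-! ## The `s`-derivative of the free semigroup slice -/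

/-- **`∂_s W_s(y) = −𝓛_(α,0) W_s (y)`.**  For bounded continuous `F : ℝ³ → ℝ³`, any rate `α`, `s > 0` and `y`, the
free semigroup slice `W_s(y) = (e^{-s/2} R_{−αs}) (e^{(1−e^{-s})Δ}F)(e^{-s/2} R_{αs} y)` is differentiable in `s` with
derivative `−lerayLin α 0 W_s (y)`. -/
theorem hasDerivAt_freeSlice (hF : Continuous F) (hC : ∀ z, ‖F z‖ ≤ C) (α : ℝ) {s : ℝ} (hs : 0 < s)
    (y : EuclideanSpace ℝ (Fin 3)) :
    HasDerivAt
      (fun t : ℝ => (Real.exp (-(t / 2)) • rotZL (-(α * t)))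
        (heatExtension F (1 - Real.exp (-t)) ((Real.exp (-(t / 2)) • rotZL (α * t)) y)))
      (-(lerayLin α (fun _ => 0)
        (fun z => (Real.exp (-(s / 2)) • rotZL (-(α * s)))
          (heatExtension F (1 - Real.exp (-s)) ((Real.exp (-(s / 2)) • rotZL (α * s)) z))) y)) s := by
  -- abbreviations
  set τ : ℝ := 1 - Real.exp (-s) with hτdef
  have hτ : 0 < τ := (heatTime_mem_Ioc hs).1
  set Ls : EuclideanSpace ℝ (Fin 3) →L[ℝ] EuclideanSpace ℝ (Fin 3) := Real.exp (-(s / 2)) • rotZL (α * s) with hLs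
  set Ms : EuclideanSpace ℝ (Fin 3) →L[ℝ] EuclideanSpace ℝ (Fin 3) := Real.exp (-(s / 2)) • rotZL (-(α * s)) with hMs
  set x : EuclideanSpace ℝ (Fin 3) := Ls y with hx
  set g : EuclideanSpace ℝ (Fin 3) → EuclideanSpace ℝ (Fin 3) := heatExtension F τ with hg
  have hg2 : ContDiff ℝ 2 g := contDiff_heatExtension_of_bound hF hC hτ
  -- (1) the inner point `t ↦ L_t y` and the heat time
  have hL : HasDerivAt (fun t : ℝ => (Real.exp (-(t / 2)) • rotZL (α * t)) y)
      ((-(1/2:ℝ) • Ls + α • rotGenL.comp Ls) y) s := by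
    have h := (hasDerivAt_exp_smul_rotZL α s).clm_apply (hasDerivAt_const s y)
    rw [map_zero, add_zero] at h
    exact h
  have hψ : HasDerivAt (fun t : ℝ => ((1 - Real.exp (-t), (Real.exp (-(t / 2)) • rotZL (α * t)) y) :
      ℝ × EuclideanSpace ℝ (Fin 3))) (Real.exp (-s), (-(1/2:ℝ) • Ls + α • rotGenL.comp Ls) y) s :=
    (hasDerivAt_heatTime s).prodMk hL
  -- (2) the caloric extension along that curve
  obtain ⟨L, hHas, hLform⟩ := hasFDerivAt_uncurry_heatExtension hF hC hτ x
  have hG : HasDerivAt (fun t : ℝ => heatExtension F (1 - Real.exp (-t)) ((Real.exp (-(t / 2)) • rotZL (α * t)) y))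
      (L (Real.exp (-s), (-(1/2:ℝ) • Ls + α • rotGenL.comp Ls) y)) s := by
    have h := hHas.comp_hasDerivAt s hψ
    exact h
  -- (3) the outer factor `t ↦ e^{-t/2} R_{−αt}`
  have hM : HasDerivAt (fun t : ℝ => Real.exp (-(t / 2)) • rotZL (-(α * t)))
      (-(1/2:ℝ) • Ms + (-α) • rotGenL.comp Ms) s := by
    have h := hasDerivAt_exp_smul_rotZL (-α) s
    simp only [neg_mul] at h
    simpa [hMs] using h
  have hW := hM.clm_apply hG
  refine hW.congr_deriv ?_
  -- (4) algebra: identify the derivative with `−𝓛_(α,0) W_s (y)`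
  rw [hLform, lerayLin_zero_conj hg2 α y]
  have hcomm : rotGenL.comp Ms = Ms.comp rotGenL := rotGenL_comp_smul_rotZL _ _
  rw [hcomm, exp_neg_half_sq' s]
  simp only [add_apply, smul_apply, ContinuousLinearMap.coe_comp, Function.comp_apply,
    rotGenL_apply, map_add, map_smul, map_sub, smul_sub, ← hx, ← hg, ← hLs, ← hMs]
  module

/-! ## Size and limits of the slice -/

/-- `‖W_s(y)‖ ≤ e^{-s/2} C` when `‖F‖ ≤ C` (maximum principle for the caloric extension, isometric rotations). -/
theorem norm_freeSlice_le (hC : ∀ z, ‖F z‖ ≤ C) (α : ℝ) {s : ℝ} (hs : 0 < s) (y : EuclideanSpace ℝ (Fin 3)) :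
    ‖(Real.exp (-(s / 2)) • rotZL (-(α * s)))
        (heatExtension F (1 - Real.exp (-s)) ((Real.exp (-(s / 2)) • rotZL (α * s)) y))‖ ≤
      Real.exp (-(s / 2)) * C := by
  rw [norm_smul_rotZL_apply, abs_of_pos (Real.exp_pos _)]
  exact mul_le_mul_of_nonneg_left (norm_heatExtension_le hC ((heatTime_mem_Ioc hs).1) _) (Real.exp_pos _).le

/-- `W_s(y) → 0` as `s → ∞`. -/
theorem tendsto_freeSlice_atTop (hC : ∀ z, ‖F z‖ ≤ C) (α : ℝ) (y : EuclideanSpace ℝ (Fin 3)) :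
    Tendsto (fun s : ℝ => (Real.exp (-(s / 2)) • rotZL (-(α * s)))
        (heatExtension F (1 - Real.exp (-s)) ((Real.exp (-(s / 2)) • rotZL (α * s)) y))) atTop (𝓝 0) := by
  rw [tendsto_zero_iff_norm_tendsto_zero]
  have hlim : Tendsto (fun s : ℝ => Real.exp (-(s / 2)) * C) atTop (𝓝 0) := by
    have h1 : Tendsto (fun s : ℝ => Real.exp (-(s / 2))) atTop (𝓝 0) := by
      have : Tendsto (fun s : ℝ => -(s / 2)) atTop atBot := by
        refine tendsto_atBot_mono (fun s => le_of_eq rfl) ?_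
        exact tendsto_neg_atTop_atBot.comp (tendsto_id.atTop_div_const (by norm_num : (0:ℝ) < 2))
      exact Real.tendsto_exp_atBot.comp this
    simpa using h1.mul_const C
  refine squeeze_zero_norm' ?_ hlim
  filter_upwards [eventually_gt_atTop (0:ℝ)] with s hs
  rw [norm_norm]
  exact norm_freeSlice_le hC α hs y

/-- `W_s(y) → F(y)` as `s → 0⁺` (continuity of the caloric extension at `t = 0⁺`, jointly in the point). -/
theorem tendsto_freeSlice_zero (hF : Continuous F) (hC : ∀ z, ‖F z‖ ≤ C) (α : ℝ) (y : EuclideanSpace ℝ (Fin 3)) :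
    Tendsto (fun s : ℝ => (Real.exp (-(s / 2)) • rotZL (-(α * s)))
        (heatExtension F (1 - Real.exp (-s)) ((Real.exp (-(s / 2)) • rotZL (α * s)) y)))
      (𝓝[>] 0) (𝓝 (F y)) := by
  -- the inner pair `(τ_s, L_s y) → (0⁺, y)` within `(0,∞) × ℝ³`
  have hin : Tendsto (fun s : ℝ => ((1 - Real.exp (-s), (Real.exp (-(s / 2)) • rotZL (α * s)) y) :
      ℝ × EuclideanSpace ℝ (Fin 3))) (𝓝[>] 0) (𝓝[Ioi 0 ×ˢ univ] ((0:ℝ), y)) := by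
    have hc1 : Continuous fun s : ℝ => 1 - Real.exp (-s) := by fun_prop
    have hc2 : Continuous fun s : ℝ => (Real.exp (-(s / 2)) • rotZL (α * s)) y :=
      (continuous_iff_continuousAt.2 fun s => (hasDerivAt_exp_smul_rotZL α s).continuousAt).clm_apply
        continuous_const
    have hval : ((1 - Real.exp (-(0:ℝ)), (Real.exp (-((0:ℝ) / 2)) • rotZL (α * 0)) y) :
        ℝ × EuclideanSpace ℝ (Fin 3)) = ((0:ℝ), y) := by
      simp [rotZ_zero]
    refine tendsto_nhdsWithin_of_tendsto_nhds_of_eventually_within _ ?_ ?_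
    · rw [← hval]
      exact ((hc1.prodMk hc2).tendsto 0).mono_left nhdsWithin_le_nhds
    · filter_upwards [self_mem_nhdsWithin] with s hs
      exact mk_mem_prod ((heatTime_mem_Ioc hs).1) (mem_univ _)
  have hheat := (tendsto_heatExtension_nhdsWithin_prod hF hC y).comp hin
  -- the outer factor `e^{-s/2} R_{−αs} → 1`
  have hout : Tendsto (fun s : ℝ => (Real.exp (-(s / 2)) • rotZL (-(α * s)) : EuclideanSpace ℝ (Fin 3) →L[ℝ]
      EuclideanSpace ℝ (Fin 3))) (𝓝[>] 0) (𝓝 (Real.exp (-((0:ℝ) / 2)) • rotZL (-(α * 0)))) := by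
    have h := (hasDerivAt_exp_smul_rotZL (-α) 0).continuousAt.tendsto
    simp only [neg_mul] at h
    exact h.mono_left nhdsWithin_le_nhds
  have hone : (Real.exp (-((0:ℝ) / 2)) • rotZL (-(α * 0)) : EuclideanSpace ℝ (Fin 3) →L[ℝ] EuclideanSpace ℝ (Fin 3)) (F y)
      = F y := by
    simp [rotZ_zero]
  have happ : Tendsto (fun p : (EuclideanSpace ℝ (Fin 3) →L[ℝ] EuclideanSpace ℝ (Fin 3)) × EuclideanSpace ℝ (Fin 3) =>
      p.1 p.2) (𝓝 ((Real.exp (-((0:ℝ) / 2)) • rotZL (-(α * 0))), F y))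
      (𝓝 ((Real.exp (-((0:ℝ) / 2)) • rotZL (-(α * 0)) : EuclideanSpace ℝ (Fin 3) →L[ℝ] EuclideanSpace ℝ (Fin 3))
        (F y))) :=
    isBoundedBilinearMap_apply.continuous.tendsto _
  rw [← hone]
  exact happ.comp (hout.prodMk_nhds hheat)

/-! ## Space derivatives of the slice -/

/-- **First space derivative of the slice**: `D W_s (y) = (e^{-s/2} R_{−αs}) ∘ D(e^{τ_sΔ}F)(x) ∘ (e^{-s/2} R_{αs})`,
`x = e^{-s/2} R_{αs} y`. -/
theorem hasFDerivAt_freeSlice_space (hF : Continuous F) (hC : ∀ z, ‖F z‖ ≤ C) (α : ℝ) {s : ℝ} (hs : 0 < s)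
    (y : EuclideanSpace ℝ (Fin 3)) :
    HasFDerivAt
      (fun z => (Real.exp (-(s / 2)) • rotZL (-(α * s)))
        (heatExtension F (1 - Real.exp (-s)) ((Real.exp (-(s / 2)) • rotZL (α * s)) z)))
      ((Real.exp (-(s / 2)) • rotZL (-(α * s))).comp
        ((fderiv ℝ (heatExtension F (1 - Real.exp (-s))) ((Real.exp (-(s / 2)) • rotZL (α * s)) y)).comp
          (Real.exp (-(s / 2)) • rotZL (α * s)))) y :=
  hasFDerivAt_conj (((contDiff_heatExtension_of_bound hF hC ((heatTime_mem_Ioc hs).1) (m := 1)).differentiable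
    one_ne_zero) _)

/-- The first space derivative of the slice as a function. -/
theorem fderiv_freeSlice (hF : Continuous F) (hC : ∀ z, ‖F z‖ ≤ C) (α : ℝ) {s : ℝ} (hs : 0 < s) :
    fderiv ℝ (fun z => (Real.exp (-(s / 2)) • rotZL (-(α * s)))
        (heatExtension F (1 - Real.exp (-s)) ((Real.exp (-(s / 2)) • rotZL (α * s)) z))) =
      fun y => ((ContinuousLinearMap.compL ℝ (EuclideanSpace ℝ (Fin 3)) (EuclideanSpace ℝ (Fin 3)) (EuclideanSpace ℝ (Fin 3))
          (Real.exp (-(s / 2)) • rotZL (-(α * s)))).comp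
        ((ContinuousLinearMap.compL ℝ (EuclideanSpace ℝ (Fin 3)) (EuclideanSpace ℝ (Fin 3)) (EuclideanSpace ℝ (Fin 3))).flip
          (Real.exp (-(s / 2)) • rotZL (α * s))))
        (fderiv ℝ (heatExtension F (1 - Real.exp (-s))) ((Real.exp (-(s / 2)) • rotZL (α * s)) y)) := by
  funext y
  rw [(hasFDerivAt_freeSlice_space hF hC α hs y).fderiv]
  simp

/-- **Size of the first space derivative**: `‖D W_s (y)‖ ≤ e^{-s} ‖D(e^{τ_sΔ}F)(x)‖`. -/
theorem norm_fderiv_freeSlice_le (hF : Continuous F) (hC : ∀ z, ‖F z‖ ≤ C) (α : ℝ) {s : ℝ} (hs : 0 < s)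
    (y : EuclideanSpace ℝ (Fin 3)) :
    ‖fderiv ℝ (fun z => (Real.exp (-(s / 2)) • rotZL (-(α * s)))
        (heatExtension F (1 - Real.exp (-s)) ((Real.exp (-(s / 2)) • rotZL (α * s)) z))) y‖ ≤
      Real.exp (-s) * ‖fderiv ℝ (heatExtension F (1 - Real.exp (-s))) ((Real.exp (-(s / 2)) • rotZL (α * s)) y)‖ := by
  have hd : Differentiable ℝ (heatExtension F (1 - Real.exp (-s))) :=
    (contDiff_heatExtension_of_bound hF hC ((heatTime_mem_Ioc hs).1) (m := 1)).differentiable one_ne_zero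
  refine (norm_fderiv_conj_le hd y).trans (le_of_eq ?_)
  rw [abs_of_pos (Real.exp_pos _), exp_neg_half_sq']

/-- **Second space derivative of the slice**: `D² W_s (y) = (A ↦ M_s ∘ A ∘ L_s) ∘ D²(e^{τ_sΔ}F)(x) ∘ L_s`. -/
theorem hasFDerivAt_fderiv_freeSlice (hF : Continuous F) (hC : ∀ z, ‖F z‖ ≤ C) (α : ℝ) {s : ℝ} (hs : 0 < s)
    (y : EuclideanSpace ℝ (Fin 3)) :
    HasFDerivAt
      (fun z => fderiv ℝ (fun z => (Real.exp (-(s / 2)) • rotZL (-(α * s)))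
        (heatExtension F (1 - Real.exp (-s)) ((Real.exp (-(s / 2)) • rotZL (α * s)) z))) z)
      ((((ContinuousLinearMap.compL ℝ (EuclideanSpace ℝ (Fin 3)) (EuclideanSpace ℝ (Fin 3)) (EuclideanSpace ℝ (Fin 3))
          (Real.exp (-(s / 2)) • rotZL (-(α * s)))).comp
        ((ContinuousLinearMap.compL ℝ (EuclideanSpace ℝ (Fin 3)) (EuclideanSpace ℝ (Fin 3)) (EuclideanSpace ℝ (Fin 3))).flip
          (Real.exp (-(s / 2)) • rotZL (α * s)))).comp
        (fderiv ℝ (fderiv ℝ (heatExtension F (1 - Real.exp (-s)))) ((Real.exp (-(s / 2)) • rotZL (α * s)) y))).comp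
        (Real.exp (-(s / 2)) • rotZL (α * s))) y := by
  have hsm : ContDiff ℝ 2 (heatExtension F (1 - Real.exp (-s))) :=
    contDiff_heatExtension_of_bound hF hC ((heatTime_mem_Ioc hs).1)
  have hd : DifferentiableAt ℝ (fderiv ℝ (heatExtension F (1 - Real.exp (-s))))
      ((Real.exp (-(s / 2)) • rotZL (α * s)) y) :=
    ((hsm.fderiv_right (m := 1) le_rfl).differentiable one_ne_zero) _
  have h1 := hd.hasFDerivAt.comp y ((Real.exp (-(s / 2)) • rotZL (α * s)).hasFDerivAt)
  have key := (((ContinuousLinearMap.compL ℝ (EuclideanSpace ℝ (Fin 3)) (EuclideanSpace ℝ (Fin 3))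
      (EuclideanSpace ℝ (Fin 3)) (Real.exp (-(s / 2)) • rotZL (-(α * s)))).comp
    ((ContinuousLinearMap.compL ℝ (EuclideanSpace ℝ (Fin 3)) (EuclideanSpace ℝ (Fin 3)) (EuclideanSpace ℝ (Fin 3))).flip
      (Real.exp (-(s / 2)) • rotZL (α * s))))).hasFDerivAt.comp y h1
  refine key.congr_of_eventuallyEq (Eventually.of_forall fun z => ?_)
  exact congrFun (fderiv_freeSlice hF hC α hs) z

/-- The second space derivative of the slice evaluated on two vectors:
`D² W_s (y)[v][w] = (e^{-s/2} R_{−αs}) (D²(e^{τ_sΔ}F)(x)[L_s v][L_s w])`. -/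
theorem fderiv_fderiv_freeSlice_apply (hF : Continuous F) (hC : ∀ z, ‖F z‖ ≤ C) (α : ℝ) {s : ℝ} (hs : 0 < s)
    (y v w : EuclideanSpace ℝ (Fin 3)) :
    fderiv ℝ (fun z => fderiv ℝ (fun z => (Real.exp (-(s / 2)) • rotZL (-(α * s)))
        (heatExtension F (1 - Real.exp (-s)) ((Real.exp (-(s / 2)) • rotZL (α * s)) z))) z) y v w =
      (Real.exp (-(s / 2)) • rotZL (-(α * s)))
        (fderiv ℝ (fderiv ℝ (heatExtension F (1 - Real.exp (-s)))) ((Real.exp (-(s / 2)) • rotZL (α * s)) y)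
          ((Real.exp (-(s / 2)) • rotZL (α * s)) v) ((Real.exp (-(s / 2)) • rotZL (α * s)) w)) := by
  rw [(hasFDerivAt_fderiv_freeSlice hF hC α hs y).fderiv]
  simp

/-- **Size of the second space derivative**: `‖D² W_s (y)‖ ≤ e^{-3s/2} ‖D²(e^{τ_sΔ}F)(x)‖`
(written with `e^{-s/2} · e^{-s}`). -/
theorem norm_fderiv_fderiv_freeSlice_le (hF : Continuous F) (hC : ∀ z, ‖F z‖ ≤ C) (α : ℝ) {s : ℝ} (hs : 0 < s)
    (y : EuclideanSpace ℝ (Fin 3)) :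
    ‖fderiv ℝ (fun z => fderiv ℝ (fun z => (Real.exp (-(s / 2)) • rotZL (-(α * s)))
        (heatExtension F (1 - Real.exp (-s)) ((Real.exp (-(s / 2)) • rotZL (α * s)) z))) z) y‖ ≤
      Real.exp (-(s / 2)) * Real.exp (-s) *
        ‖fderiv ℝ (fderiv ℝ (heatExtension F (1 - Real.exp (-s)))) ((Real.exp (-(s / 2)) • rotZL (α * s)) y)‖ := by
  refine ContinuousLinearMap.opNorm_le_bound₂ _ (by positivity) fun v w => ?_
  rw [fderiv_fderiv_freeSlice_apply hF hC α hs y v w, norm_smul_rotZL_apply, abs_of_pos (Real.exp_pos _)]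
  set B := fderiv ℝ (fderiv ℝ (heatExtension F (1 - Real.exp (-s)))) ((Real.exp (-(s / 2)) • rotZL (α * s)) y)
  have h1 : ‖B ((Real.exp (-(s / 2)) • rotZL (α * s)) v) ((Real.exp (-(s / 2)) • rotZL (α * s)) w)‖ ≤
      ‖B‖ * ‖(Real.exp (-(s / 2)) • rotZL (α * s)) v‖ * ‖(Real.exp (-(s / 2)) • rotZL (α * s)) w‖ :=
    B.le_opNorm₂ _ _
  rw [norm_smul_rotZL_apply, norm_smul_rotZL_apply, abs_of_pos (Real.exp_pos _)] at h1
  calc Real.exp (-(s / 2)) * ‖B ((Real.exp (-(s / 2)) • rotZL (α * s)) v) ((Real.exp (-(s / 2)) • rotZL (α * s)) w)‖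
      ≤ Real.exp (-(s / 2)) * (‖B‖ * (Real.exp (-(s / 2)) * ‖v‖) * (Real.exp (-(s / 2)) * ‖w‖)) :=
        mul_le_mul_of_nonneg_left h1 (Real.exp_pos _).le
    _ = Real.exp (-(s / 2)) * Real.exp (-(s / 2)) ^ 2 * ‖B‖ * ‖v‖ * ‖w‖ := by ring
    _ = Real.exp (-(s / 2)) * Real.exp (-s) * ‖B‖ * ‖v‖ * ‖w‖ := by rw [exp_neg_half_sq']

/-! ## The derivatives of the caloric extension that enter (bounded `C¹` data) -/

/-- For `F ∈ C¹` bounded with `‖DF‖ ≤ C₁`: `‖D(e^{τΔ}F)(x)‖ ≤ C₁` (the derivative falls on the data and the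
kernel has mass one). -/
theorem norm_fderiv_heatExtension_le_of_C1 (hF : ContDiff ℝ 1 F) (hC : ∀ z, ‖F z‖ ≤ C) {C₁ : ℝ}
    (hC₁ : ∀ z, ‖fderiv ℝ F z‖ ≤ C₁) {τ : ℝ} (hτ : 0 < τ) (x : EuclideanSpace ℝ (Fin 3)) :
    ‖fderiv ℝ (heatExtension F τ) x‖ ≤ C₁ := by
  rw [fderiv_heatExtension_of_bounded hF hC hC₁ hτ x]
  exact norm_heatExtension_le_of_bound hC₁ hτ x

/-- For `F ∈ C¹` bounded with `‖DF‖ ≤ C₁`: `‖D²(e^{τΔ}F)(x)‖ ≤ 2^{3/2} τ^{-1/2} C₁` (one derivative on the data, one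
on the kernel). -/
theorem norm_fderiv_fderiv_heatExtension_le_of_C1 (hF : ContDiff ℝ 1 F) (hC : ∀ z, ‖F z‖ ≤ C) {C₁ : ℝ}
    (hC₁ : ∀ z, ‖fderiv ℝ F z‖ ≤ C₁) {τ : ℝ} (hτ : 0 < τ) (x : EuclideanSpace ℝ (Fin 3)) :
    ‖fderiv ℝ (fderiv ℝ (heatExtension F τ)) x‖ ≤ (2 : ℝ) ^ ((3 : ℝ) / 2) * τ ^ (-(1 / 2 : ℝ)) * C₁ := by
  have hfun : fderiv ℝ (heatExtension F τ) = heatExtension (fderiv ℝ F) τ :=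
    funext fun z => fderiv_heatExtension_of_bounded hF hC hC₁ hτ z
  rw [hfun]
  have hfin : (Module.finrank ℝ (EuclideanSpace ℝ (Fin 3)) : ℝ) = 3 := by
    rw [finrank_euclideanSpace_fin]; norm_num
  have h := norm_fderiv_heatExtension_le_of_bounded
    ((hF.continuous_fderiv one_ne_zero).aestronglyMeasurable) hC₁ hτ x
  rwa [hfin] at h

end Slice

end Summit.NavierStokesRegularity.NavierStokesRegularity.Theorems.KelvinGate

end
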